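import Mathlib.Analysis.Calculus.BumpFunction.InnerProduct
import Mathlib.Analysis.Calculus.FDeriv.Equiv
import Literature.Analysis.FluidPDE.WholeSpaceIBP
import HarnessLib

/-!
# The lacunary harmonic-quadratic family: bounded Laplacian, unbounded Hessian (Gilbarg–Trudinger, Problem 4.9)

Barrier catalogue `Literature/Barriers/NavierStokesRegularity/` (D-0021) — WITNESS MODULE of the entry
`SupNormCalderonZygmundFailure` («no sup-norm Calderón–Zygmund / Schauder estimate at the endpoint:
second derivatives, Helmholtz–Hodge (Leray) components and velocity gradients are not controlled in
`L^∞` by the Laplacian, the field, the vorticity»). Filed by the NS-CLAIMS sweep (D-0090, cell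
`ns-claims`, seat `ns-claims-salvage-p1`); everything PROVED, zero fact debt, no definition of a new
mathematical notion (the `def`s below are the explicit witness functions).

## The construction (Gilbarg–Trudinger 2001, Ch. 4, Problem 4.9 (a), made quantitative)

Let `P(x) = x₀x₁` (homogeneous HARMONIC quadratic on `ℝ³`, `∂₀∂₁P = 1`, every other second partial
zero), `χ` a smooth bump `≡ 1` on the unit ball with `supp χ ⊆ B(0,2)` (Mathlib `ContDiffBump`),
`w = χ·P`, and `u_N(x) = Σ_{k<N} 16^{-k} w(4^k x)` (`SupNormCZ.lac N`). Gilbarg–Trudinger ask to show,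
with weights `c_k → 0`, `Σ c_k = ∞` and dilations `2^k`, that `f = Σ c_k Δ(χP)(2^k x)` is continuous
while `Δu = f` has no `C²` solution near `0` («if `f` is only continuous the Newtonian potential need
not be twice differentiable», Notes to Ch. 4). The finite unit-weight sums are the QUANTITATIVE form:
* `D²` is scale invariant under `x ↦ 16^{-k} w(4^k x)`: `D²u_N(x) = Σ_{k<N} (D²w)(4^k x)` (`D2_lac`);
* inside the unit ball `D²w = D²P`, outside `B(0,2)` `D²w = 0`; so for every pair of directions
  `(a, c)` with `a₀c₁ + c₀a₁ = 0` — all coordinate pairs except `{e₀, e₁}`, in particular the diagonal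
  ones — `∂_c∂_a w` lives in the shell `1 ≤ |y| ≤ 2`, and since the dilation factor `4` exceeds the
  shell ratio `2`, at most ONE point `4^k x` is in the shell (`abs_sum_shell_le`): `|∂_c∂_a u_N| ≤ B`
  and `|Δu_N| ≤ M` on `ℝ³` uniformly in `N` (`exists_abs_D2_lac_le`, `exists_abs_laplacian_lac_le`);
* at the origin every piece contributes `∂₀∂₁P = 1`: `∂₀∂₁u_N(0) = N` (`D2_lac_e1_e0_zero`) — the
  discretised logarithm of the continuous version `x₀x₁ log|x|`.
So `(u_N) ⊂ C_c^∞(ℝ³)` (support in `B̄(0,2)`) has `sup|Δu_N| ≤ M` and `∂₀∂₁u_N(0) = N → ∞`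
(`lacunary_witness`). The entry module turns this scalar family into the three vector-valued witness
families (Hessian vs Laplacian, Hodge components vs field, velocity gradient vs vorticity).

Rendering: `E3 = EuclideanSpace ℝ (Fin 3)`, `eᵢ = single i 1`, `SupNormCZ.D2 f a c x = D(y ↦ Df(y) a)(x) c`
(the tree's nested-`fderiv` convention of `Literature.Analysis.FluidPDE.laplacian_eq_sum_fderiv_fderiv`),
Mathlib's `Δ`. Tree search: `lean search 'Schauder.*(fail|counter)|unbounded on L'` — prose only
(`Cruxes/AveragedTypeIBlowup/Disproof.lean`), no kernel statement; the `L²` companion (the Hessian IS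
controlled by the Laplacian in `L²`, Stein Ch. III §1.3 Prop. 3 at `p = 2`) is `FluidPDE/HessianLaplacian`.
References: D. Gilbarg, N. S. Trudinger, *Elliptic PDE of Second Order* (2001), Ch. 4 Problem 4.9 (a)
and Notes; E. M. Stein, *Singular Integrals…* (1970), Ch. III §1.3 Prop. 3 (`1 < p < ∞` only).

WHAT THIS IS NOT: not a claim about NS regularity or blow-up; not a claim about any author beyond the
typed locator. A calculus construction on `ℝ³`.
-/

noncomputable section

open Set Filter Topology InnerProductSpace Function Metric
open scoped Laplacian ContDiff

namespace Literature.Barriers.NavierStokesRegularity.SupNormCZ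

open Literature.Analysis.FluidPDE

/-- Local notation for physical space `ℝ³ = EuclideanSpace ℝ (Fin 3)`. -/
local notation "E3" => EuclideanSpace ℝ (Fin 3)

/-! ### Second directional derivatives: notation and calculus -/

/-- The unit coordinate vector `eᵢ = EuclideanSpace.single i 1` of `ℝ³` (plumbing abbreviation for the
directions in which the witnesses are differentiated). [folklore] -/
def e (i : Fin 3) : E3 := EuclideanSpace.single i (1 : ℝ)

/-- `(eᵢ)ⱼ = δⱼᵢ` (coordinates of the standard basis vectors of the witness construction,
Gilbarg–Trudinger Problem 4.9 (a): `P = x₁x₂`, `D₁₂P = 1`).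
[cite: GilbargTrudinger2001, Ch. 4 Problem 4.9 (a)] -/
@[simp] theorem e_apply (i j : Fin 3) : e i j = if j = i then 1 else 0 := by
  simp [e]

/-- `‖eᵢ‖ = 1` (the test directions of the witness construction are unit vectors).
[cite: GilbargTrudinger2001, Ch. 4 Problem 4.9 (a)] -/
@[simp] theorem norm_e (i : Fin 3) : ‖e i‖ = 1 := by
  simp [e]

/-- The iterated directional derivative `∂_c ∂_a f (x) = D(y ↦ Df(y) a)(x) c` of a scalar function
on `ℝ³` (for `C²` functions this is the Hessian entry `D²f(x)(c, a)`, symmetric in `a, c`); the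
tree's nested-`fderiv` convention (`laplacian_eq_sum_fderiv_fderiv`: `Δf = Σᵢ ∂ᵢ∂ᵢ f`). Plumbing
abbreviation. [folklore] -/
def D2 (f : E3 → ℝ) (a c : E3) (x : E3) : ℝ := fderiv ℝ (fun y => fderiv ℝ f y a) x c

/-- `D2` only depends on the germ: functions agreeing near `x` have the same second derivatives
at `x`. [folklore] -/
private theorem D2_congr_of_eventuallyEq {f g : E3 → ℝ} {x : E3} (h : f =ᶠ[𝓝 x] g) (a c : E3) :
    D2 f a c x = D2 g a c x := by
  have h1 : (fun y => fderiv ℝ f y a) =ᶠ[𝓝 x] fun y => fderiv ℝ g y a :=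
    (h.fderiv (𝕜 := ℝ)).mono fun y hy => by
      show fderiv ℝ f y a = fderiv ℝ g y a
      rw [hy]
  rw [D2, D2, h1.fderiv_eq]

/-- Scaling of second derivatives: `D²(f(c·))(x) = c² (D²f)(cx)`. [folklore] -/
private theorem D2_comp_smul (f : E3 → ℝ) (c : ℝ) (a b x : E3) :
    D2 (fun y => f (c • y)) a b x = c ^ 2 * D2 f a b (c • x) := by
  unfold D2
  set g : E3 → ℝ := fun z => fderiv ℝ f z a with hg
  have h1 : (fun y => fderiv ℝ (fun z => f (c • z)) y a) = c • fun y => g (c • y) := by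
    funext y
    simp only [Pi.smul_apply, smul_eq_mul, hg]
    rw [fderiv_comp_smul c]
    simp [smul_eq_mul]
  rw [h1, fderiv_const_smul_field, Pi.smul_apply, fderiv_comp_smul c]
  simp only [FunLike.coe_smul, Pi.smul_apply, smul_eq_mul, hg]
  ring

/-- `D²(κ f) = κ D²f`. [folklore] -/
private theorem D2_const_mul (f : E3 → ℝ) (κ : ℝ) (a b x : E3) :
    D2 (fun y => κ * f y) a b x = κ * D2 f a b x := by
  unfold D2
  have h1 : (fun y => fderiv ℝ (fun z => κ * f z) y a) = κ • fun y => fderiv ℝ f y a := by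
    funext y
    rw [show (fun z => κ * f z) = κ • f from rfl, fderiv_const_smul_field]
    simp [smul_eq_mul]
  rw [h1, fderiv_const_smul_field]
  simp [smul_eq_mul]

/-- `D²` of a finite sum of `C²` functions is the sum of the `D²`. [folklore] -/
private theorem D2_finset_sum {ι : Type*} (s : Finset ι) {F : ι → E3 → ℝ}
    (hF : ∀ k ∈ s, ContDiff ℝ 2 (F k)) (a b x : E3) :
    D2 (fun y => ∑ k ∈ s, F k y) a b x = ∑ k ∈ s, D2 (F k) a b x := by
  unfold D2
  have hd : ∀ k ∈ s, ∀ y, DifferentiableAt ℝ (F k) y := fun k hk y =>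
    ((hF k hk).differentiable (by norm_num)) y
  have hd2 : ∀ k ∈ s, DifferentiableAt ℝ (fun y => fderiv ℝ (F k) y a) x := fun k hk =>
    ((((hF k hk).fderiv_right (m := 1) le_rfl).clm_apply contDiff_const).differentiable
      one_ne_zero) x
  have h1 : (fun y => fderiv ℝ (fun z => ∑ k ∈ s, F k z) y a) =
      fun y => ∑ k ∈ s, (fun y => fderiv ℝ (F k) y a) y := by
    funext y
    rw [fderiv_fun_sum fun k hk => hd k hk y, FunLike.coe_sum, Finset.sum_apply]
  rw [h1, fderiv_fun_sum hd2, FunLike.coe_sum, Finset.sum_apply]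

/-- A `C²` compactly supported function has bounded second derivatives (each `∂_c∂_a f` is continuous
with compact support). [folklore] -/
private theorem exists_abs_D2_le {f : E3 → ℝ} (hf : ContDiff ℝ 2 f) (hc : HasCompactSupport f)
    (a b : E3) : ∃ B : ℝ, 0 ≤ B ∧ ∀ x, |D2 f a b x| ≤ B := by
  have hcont : Continuous fun x => D2 f a b x :=
    (((hf.fderiv_right (m := 1) le_rfl).clm_apply contDiff_const).continuous_fderiv
      one_ne_zero).clm_apply continuous_const
  have hsupp : HasCompactSupport fun x => D2 f a b x :=
    (hc.fderiv_apply (𝕜 := ℝ) a).fderiv_apply (𝕜 := ℝ) b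
  obtain ⟨C, hC⟩ := hcont.bounded_above_of_compact_support hsupp
  refine ⟨max C 0, le_max_right _ _, fun x => ?_⟩
  have h := hC x
  rw [Real.norm_eq_abs] at h
  exact h.trans (le_max_left _ _)

/-! ### The piece `w = χ · x₀x₁` -/

/-- The cut-off `η` of Gilbarg–Trudinger Problem 4.9 (a): a smooth bump `≡ 1` on the closed unit
ball, supported in the ball of radius `2` (Mathlib `ContDiffBump` centred at `0`). [folklore] -/
def χ : ContDiffBump (0 : E3) := ⟨1, 2, one_pos, one_lt_two⟩

/-- The homogeneous harmonic quadratic `P(x) = x₀ x₁` of Gilbarg–Trudinger Problem 4.9 (a)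
(`ΔP = 0`, `∂₀∂₁ P = 1`, all other second partials zero). [folklore] -/
def m (x : E3) : ℝ := x 0 * x 1

/-- The piece `w = χ · P`: smooth, compactly supported, equal to `x₀x₁` on the unit ball
(Gilbarg–Trudinger's `ηP`). [folklore] -/
def w (x : E3) : ℝ := χ x * m x

/-- `P = x₀x₁` is smooth. [folklore] -/
private theorem m_contDiff : ContDiff ℝ ∞ m :=
  (EuclideanSpace.proj (0 : Fin 3) : E3 →L[ℝ] ℝ).contDiff.mul
    (EuclideanSpace.proj (1 : Fin 3) : E3 →L[ℝ] ℝ).contDiff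

/-- `DP(y) a = a₀ y₁ + y₀ a₁`. [folklore] -/
private theorem fderiv_m_apply (y a : E3) : fderiv ℝ m y a = a 0 * y 1 + y 0 * a 1 := by
  have h : HasFDerivAt m (y 0 • (EuclideanSpace.proj 1 : E3 →L[ℝ] ℝ) +
      y 1 • (EuclideanSpace.proj 0 : E3 →L[ℝ] ℝ)) y :=
    (EuclideanSpace.proj (0 : Fin 3) : E3 →L[ℝ] ℝ).hasFDerivAt.mul
      (EuclideanSpace.proj (1 : Fin 3) : E3 →L[ℝ] ℝ).hasFDerivAt
  rw [h.fderiv]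
  simp
  ring

/-- The Hessian of `P = x₀x₁` is the constant form `∂_c∂_a P = a₀c₁ + c₀a₁` (so `ΔP = 0` and
`∂₀∂₁P = 1`, as in Gilbarg–Trudinger Problem 4.9 (a)). [cite: GilbargTrudinger2001, Ch. 4 Problem 4.9 (a)] -/
theorem D2_m (a c x : E3) : D2 m a c x = a 0 * c 1 + c 0 * a 1 := by
  unfold D2
  have h1 : (fun y => fderiv ℝ m y a) = fun y : E3 => a 0 * y 1 + y 0 * a 1 :=
    funext fun y => fderiv_m_apply y a
  have h : HasFDerivAt (fun y : E3 => a 0 * y 1 + y 0 * a 1)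
      (a 0 • (EuclideanSpace.proj 1 : E3 →L[ℝ] ℝ) + a 1 • (EuclideanSpace.proj 0 : E3 →L[ℝ] ℝ)) x :=
    ((((EuclideanSpace.proj (1 : Fin 3) : E3 →L[ℝ] ℝ).hasFDerivAt).const_mul (a 0)).add
      (((EuclideanSpace.proj (0 : Fin 3) : E3 →L[ℝ] ℝ).hasFDerivAt).mul_const (a 1))).congr_fderiv
      (by ext h; simp)
  rw [h1, h.fderiv]
  simp
  ring

/-- `w` is smooth. [cite: GilbargTrudinger2001, Ch. 4 Problem 4.9 (a)] -/
theorem w_contDiff : ContDiff ℝ ∞ w := χ.contDiff.mul m_contDiff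

/-- `w` is `C²`. [cite: GilbargTrudinger2001, Ch. 4 Problem 4.9 (a)] -/
theorem w_contDiff_two : ContDiff ℝ 2 w := w_contDiff.of_le (by norm_cast)

/-- `w` has compact support. [cite: GilbargTrudinger2001, Ch. 4 Problem 4.9 (a)] -/
theorem w_hasCompactSupport : HasCompactSupport w := χ.hasCompactSupport.mul_right

/-- On the open unit ball `w` agrees with `P = x₀x₁` near every point (`χ ≡ 1` there).
[cite: GilbargTrudinger2001, Ch. 4 Problem 4.9 (a)] -/
theorem w_eventuallyEq_m {x : E3} (hx : ‖x‖ < 1) : w =ᶠ[𝓝 x] m := by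
  have h := χ.eventuallyEq_one_of_mem_ball (x := x) (by simpa [χ] using hx)
  filter_upwards [h] with y hy
  simp [w, hy]

/-- Off the closed ball of radius `2`, `w` vanishes near every point.
[cite: GilbargTrudinger2001, Ch. 4 Problem 4.9 (a)] -/
theorem w_eventuallyEq_zero {x : E3} (hx : 2 < ‖x‖) : w =ᶠ[𝓝 x] fun _ => 0 := by
  have ho : IsOpen {y : E3 | 2 < ‖y‖} := isOpen_lt continuous_const continuous_norm
  filter_upwards [ho.mem_nhds hx] with y hy
  have : χ y = 0 := χ.zero_of_le_dist (by simpa [χ] using le_of_lt hy)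
  simp [w, this]

/-- Inside the unit ball the Hessian of `w` is that of `P`: `∂_c∂_a w(x) = a₀c₁ + c₀a₁`.
[cite: GilbargTrudinger2001, Ch. 4 Problem 4.9 (a)] -/
theorem D2_w_of_norm_lt_one {x : E3} (hx : ‖x‖ < 1) (a c : E3) :
    D2 w a c x = a 0 * c 1 + c 0 * a 1 := by
  rw [D2_congr_of_eventuallyEq (w_eventuallyEq_m hx), D2_m]

/-- Outside the ball of radius `2` the Hessian of `w` vanishes.
[cite: GilbargTrudinger2001, Ch. 4 Problem 4.9 (a)] -/
theorem D2_w_of_two_lt_norm {x : E3} (hx : 2 < ‖x‖) (a c : E3) : D2 w a c x = 0 := by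
  rw [D2_congr_of_eventuallyEq (w_eventuallyEq_zero hx)]
  simp [D2]

/-! ### The lacunary sum `u_N = Σ_{k<N} 16^{-k} w(4^k x)` -/

/-- The `k`-th piece `16^{-k} w(4^k x)`: a copy of `w` living at scale `4^{-k}`, normalised so that
its second derivatives are those of `w` at the rescaled point (Gilbarg–Trudinger's
`c_k (ηP)(t_k x)/t_k²` with `c_k = 1`, `t_k = 4^k`). [folklore] -/
def piece (k : ℕ) (x : E3) : ℝ := (((4 : ℝ) ^ k)⁻¹) ^ 2 * w ((4 : ℝ) ^ k • x)

/-- The lacunary sum `u_N = Σ_{k<N} 16^{-k} w(4^k x)` (finite, unit-weight form of the series of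
Gilbarg–Trudinger Problem 4.9 (a)). [folklore] -/
def lac (N : ℕ) (x : E3) : ℝ := ∑ k ∈ Finset.range N, piece k x

/-- Each piece is smooth. [cite: GilbargTrudinger2001, Ch. 4 Problem 4.9 (a)] -/
theorem piece_contDiff (k : ℕ) : ContDiff ℝ ∞ (piece k) :=
  contDiff_const.mul (w_contDiff.comp (contDiff_id.const_smul _))

/-- The lacunary sum `u_N` is smooth. [cite: GilbargTrudinger2001, Ch. 4 Problem 4.9 (a)] -/
theorem lac_contDiff (N : ℕ) : ContDiff ℝ ∞ (lac N) :=
  ContDiff.sum fun k _ => piece_contDiff k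

/-- The lacunary sum `u_N` is `C²`. [cite: GilbargTrudinger2001, Ch. 4 Problem 4.9 (a)] -/
theorem lac_contDiff_two (N : ℕ) : ContDiff ℝ 2 (lac N) := (lac_contDiff N).of_le (by norm_cast)

/-- A piece vanishes off the closed ball of radius `2` (indeed of radius `2·4^{-k}`).
[cite: GilbargTrudinger2001, Ch. 4 Problem 4.9 (a)] -/
theorem piece_eq_zero {k : ℕ} {x : E3} (hx : 2 < ‖x‖) : piece k x = 0 := by
  have h4 : (1 : ℝ) ≤ (4 : ℝ) ^ k := one_le_pow₀ (by norm_num)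
  have hn : 2 < ‖(4 : ℝ) ^ k • x‖ := by
    rw [norm_smul, Real.norm_of_nonneg (by positivity)]
    nlinarith [norm_nonneg x]
  have : w ((4 : ℝ) ^ k • x) = 0 := (w_eventuallyEq_zero hn).self_of_nhds
  simp [piece, this]

/-- The lacunary sum vanishes off the closed ball of radius `2`.
[cite: GilbargTrudinger2001, Ch. 4 Problem 4.9 (a)] -/
theorem lac_eq_zero {N : ℕ} {x : E3} (hx : 2 < ‖x‖) : lac N x = 0 :=
  Finset.sum_eq_zero fun _ _ => piece_eq_zero hx

/-- The lacunary sum `u_N` has compact support (in the closed ball of radius `2`).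
[cite: GilbargTrudinger2001, Ch. 4 Problem 4.9 (a)] -/
theorem lac_hasCompactSupport (N : ℕ) : HasCompactSupport (lac N) := by
  refine HasCompactSupport.intro (ProperSpace.isCompact_closedBall (0 : E3) 2) fun x hx => ?_
  rw [mem_closedBall, dist_zero_right, not_le] at hx
  exact lac_eq_zero hx

/-- Second derivatives of a piece are those of `w` at the rescaled point (scale invariance of
`D²` under `x ↦ 16^{-k} w(4^k x)`). [cite: GilbargTrudinger2001, Ch. 4 Problem 4.9 (a)] -/
theorem D2_piece (k : ℕ) (a b x : E3) :
    D2 (piece k) a b x = D2 w a b ((4 : ℝ) ^ k • x) := by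
  unfold piece
  rw [D2_const_mul, D2_comp_smul]
  have h4 : (4 : ℝ) ^ k ≠ 0 := pow_ne_zero k (by norm_num)
  field_simp

/-- Second derivatives of the lacunary sum: `D²u_N(x) = Σ_{k<N} (D²w)(4^k x)`.
[cite: GilbargTrudinger2001, Ch. 4 Problem 4.9 (a)] -/
theorem D2_lac (N : ℕ) (a b x : E3) :
    D2 (lac N) a b x = ∑ k ∈ Finset.range N, D2 w a b ((4 : ℝ) ^ k • x) := by
  unfold lac
  rw [D2_finset_sum _ (fun k _ => (piece_contDiff k).of_le (by norm_cast))]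
  exact Finset.sum_congr rfl fun k _ => D2_piece k a b x

/-! ### The lacunary counting lemma: at most one dyadic shell is active -/

/-- **Lacunary sums of a shell-supported bounded function.** If `|g| ≤ B`, `g` vanishes on the open
unit ball and off the closed ball of radius `2`, then for every `x` at most ONE of the points
`4^k x` (`k < N`) lies in the shell `1 ≤ ‖y‖ ≤ 2` (two of them would have norms in ratio `≥ 4 > 2`),
so `|Σ_{k<N} g(4^k x)| ≤ B` uniformly in `N` and `x` — the disjoint-scales bookkeeping of
Gilbarg–Trudinger Problem 4.9 (a) (there with ratio-`2` dilations and weights `c_k → 0`).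
[cite: GilbargTrudinger2001, Ch. 4 Problem 4.9 (a)] -/
theorem abs_sum_shell_le {g : E3 → ℝ} {B : ℝ} (hB0 : 0 ≤ B) (hB : ∀ y, |g y| ≤ B)
    (hin : ∀ y : E3, ‖y‖ < 1 → g y = 0) (hout : ∀ y : E3, 2 < ‖y‖ → g y = 0) (N : ℕ) (x : E3) :
    |∑ k ∈ Finset.range N, g ((4 : ℝ) ^ k • x)| ≤ B := by
  -- norms of the rescaled points
  have hnorm : ∀ k : ℕ, ‖(4 : ℝ) ^ k • x‖ = (4 : ℝ) ^ k * ‖x‖ := fun k => by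
    rw [norm_smul, Real.norm_of_nonneg (by positivity)]
  -- an active index has `1 ≤ 4^k ‖x‖ ≤ 2`
  have hact : ∀ k : ℕ, g ((4 : ℝ) ^ k • x) ≠ 0 →
      1 ≤ (4 : ℝ) ^ k * ‖x‖ ∧ (4 : ℝ) ^ k * ‖x‖ ≤ 2 := by
    intro k hk
    constructor
    · by_contra h
      exact hk (hin _ (by rw [hnorm]; linarith))
    · by_contra h
      exact hk (hout _ (by rw [hnorm]; linarith))
  -- two distinct indices cannot both be active
  have huniq : ∀ k j : ℕ, g ((4 : ℝ) ^ k • x) ≠ 0 → g ((4 : ℝ) ^ j • x) ≠ 0 → k = j := by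
    intro k j hk hj
    obtain ⟨hk1, hk2⟩ := hact k hk
    obtain ⟨hj1, hj2⟩ := hact j hj
    by_contra hne
    rcases lt_or_gt_of_ne hne with h | h
    · have hp : (4 : ℝ) ^ (k + 1) ≤ (4 : ℝ) ^ j := pow_le_pow_right₀ (by norm_num) h
      have : (4 : ℝ) ^ (k + 1) * ‖x‖ ≤ (4 : ℝ) ^ j * ‖x‖ :=
        mul_le_mul_of_nonneg_right hp (norm_nonneg x)
      rw [pow_succ] at this
      nlinarith
    · have hp : (4 : ℝ) ^ (j + 1) ≤ (4 : ℝ) ^ k := pow_le_pow_right₀ (by norm_num) h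
      have : (4 : ℝ) ^ (j + 1) * ‖x‖ ≤ (4 : ℝ) ^ k * ‖x‖ :=
        mul_le_mul_of_nonneg_right hp (norm_nonneg x)
      rw [pow_succ] at this
      nlinarith
  by_cases h : ∃ k ∈ Finset.range N, g ((4 : ℝ) ^ k • x) ≠ 0
  · obtain ⟨k₀, hk₀, hg⟩ := h
    rw [Finset.sum_eq_single_of_mem k₀ hk₀ fun k _ hne => ?_]
    · exact hB _
    · by_contra hk
      exact hne (huniq k k₀ hk hg)
  · push Not at h
    rw [Finset.sum_eq_zero h, abs_zero]
    exact hB0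

/-! ### Consequences for the lacunary sum -/

/-- **Good directions stay bounded.** For a pair of directions `(a, c)` with `a₀c₁ + c₀a₁ = 0` —
i.e. every pair of coordinate directions except `{e₀, e₁}` — the second derivative `∂_c∂_a u_N`
is bounded on `ℝ³` UNIFORMLY in `N` (bound = a bound of `∂_c∂_a w`, by the counting lemma).
[cite: GilbargTrudinger2001, Ch. 4 Problem 4.9 (a)] -/
theorem exists_abs_D2_lac_le {a c : E3} (hac : a 0 * c 1 + c 0 * a 1 = 0) :
    ∃ B : ℝ, 0 ≤ B ∧ ∀ N x, |D2 (lac N) a c x| ≤ B := by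
  obtain ⟨B, hB0, hB⟩ := exists_abs_D2_le w_contDiff_two w_hasCompactSupport a c
  refine ⟨B, hB0, fun N x => ?_⟩
  rw [D2_lac]
  refine abs_sum_shell_le hB0 hB (fun y hy => ?_) (fun y hy => D2_w_of_two_lt_norm hy a c) N x
  rw [D2_w_of_norm_lt_one hy, hac]

/-- **The bad direction grows linearly**: `∂₀∂₁ u_N(0) = N` — every piece contributes
`∂₀∂₁(x₀x₁) = 1` at the origin (the divergence `Σ c_k = ∞` of Gilbarg–Trudinger Problem 4.9 (a)).
[cite: GilbargTrudinger2001, Ch. 4 Problem 4.9 (a)] -/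
theorem D2_lac_e1_e0_zero (N : ℕ) : D2 (lac N) (e 1) (e 0) 0 = N := by
  rw [D2_lac]; simp only [smul_zero]; rw [D2_w_of_norm_lt_one (by simp) (e 1) (e 0)]; simp

/-- Symmetric form: `∂₁∂₀ u_N(0) = N`. [cite: GilbargTrudinger2001, Ch. 4 Problem 4.9 (a)] -/
theorem D2_lac_e0_e1_zero (N : ℕ) : D2 (lac N) (e 0) (e 1) 0 = N := by
  rw [D2_lac]; simp only [smul_zero]; rw [D2_w_of_norm_lt_one (by simp) (e 0) (e 1)]; simp

/-- **The Laplacian stays bounded**: `Δu_N = ∂₀∂₀u_N + ∂₁∂₁u_N + ∂₂∂₂u_N` is a sum of three good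
directions, hence `|Δ u_N (x)| ≤ M` for all `N`, `x`, with ONE constant `M > 0` — while
`∂₀∂₁u_N(0) = N` (`D2_lac_e1_e0_zero`): the quantitative content of Gilbarg–Trudinger Problem
4.9 (a) / Stein's remark that Prop. 3 (`‖∂ⱼ∂ₖf‖_p ≤ A_p‖Δf‖_p`) is a `1 < p < ∞` statement.
[cite: GilbargTrudinger2001, Ch. 4 Problem 4.9 (a)] -/
theorem exists_abs_laplacian_lac_le : ∃ M : ℝ, 0 < M ∧ ∀ N x, |(Δ (lac N)) x| ≤ M := by
  obtain ⟨B₀, h0, hB₀⟩ := exists_abs_D2_lac_le (a := e 0) (c := e 0) (by simp)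
  obtain ⟨B₁, h1, hB₁⟩ := exists_abs_D2_lac_le (a := e 1) (c := e 1) (by simp)
  obtain ⟨B₂, h2, hB₂⟩ := exists_abs_D2_lac_le (a := e 2) (c := e 2) (by simp)
  refine ⟨B₀ + B₁ + B₂ + 1, by linarith, fun N x => ?_⟩
  have hΔ : (Δ (lac N)) x = D2 (lac N) (e 0) (e 0) x + D2 (lac N) (e 1) (e 1) x +
      D2 (lac N) (e 2) (e 2) x := by
    rw [laplacian_eq_sum_fderiv_fderiv (EuclideanSpace.basisFun (Fin 3) ℝ)
      ((lac_contDiff N).of_le (by norm_cast)) x, Fin.sum_univ_three]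
    simp only [EuclideanSpace.basisFun_apply]
    simp only [D2, e]
  rw [hΔ]
  have := hB₀ N x; have := hB₁ N x; have := hB₂ N x
  calc |D2 (lac N) (e 0) (e 0) x + D2 (lac N) (e 1) (e 1) x + D2 (lac N) (e 2) (e 2) x|
      ≤ |D2 (lac N) (e 0) (e 0) x| + |D2 (lac N) (e 1) (e 1) x| + |D2 (lac N) (e 2) (e 2) x| :=
        (abs_add_le _ _).trans (by gcongr; exact abs_add_le _ _)
    _ ≤ B₀ + B₁ + B₂ + 1 := by linarith

/-- **The sup of the Laplacian does not control the Hessian, lacunary form** (Gilbarg–Trudinger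
Problem 4.9 (a), quantitative): one constant `M` with `|Δu_N| ≤ M` everywhere for every `N`, and
`∂₀∂₁u_N(0) = N`, for the explicit family `u_N = Σ_{k<N} 16^{-k}(χ·x₀x₁)(4^k x) ∈ C_c^∞(ℝ³)`.
[cite: GilbargTrudinger2001, Ch. 4 Problem 4.9 (a)] -/
theorem lacunary_witness : ∃ M : ℝ, 0 < M ∧ ∀ N : ℕ,
    ContDiff ℝ ∞ (lac N) ∧ HasCompactSupport (lac N) ∧ (∀ x, |(Δ (lac N)) x| ≤ M) ∧
    fderiv ℝ (fun y => fderiv ℝ (lac N) y (EuclideanSpace.single 1 1)) 0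
      (EuclideanSpace.single 0 1) = N := by
  obtain ⟨M, hM, hΔ⟩ := exists_abs_laplacian_lac_le
  exact ⟨M, hM, fun N => ⟨lac_contDiff N, lac_hasCompactSupport N, hΔ N, D2_lac_e1_e0_zero N⟩⟩

end Literature.Barriers.NavierStokesRegularity.SupNormCZ

end
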